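import Summits.CriticalPhenomena.PercolationContinuityZ3.Theorems.PercAnnulusCrossingIICMultiPointSeparated
import Summits.CriticalPhenomena.PercolationContinuityZ3.Theorems.PercAnnulusCrossingIICShellVolumesDecorrelate
import HarnessLib

/-!
# The multipoint factorisation for finitely many sites: padding finite data to separated sequences (lane RSW3, p1 gen 19)

builds on p205010 (kernel theorem, internal audit signed; external expert review pending) — NOT used in this file (only `p_c(ℤ^d) > 0`).

RSW3 lane (LANE 3 `prim-rsw3`), seat `prim-rsw3-p1` (gen 19).  Helper file (`--supports stmt-CriticalPhenomena-4575`);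
no definitions, no sorries.  Memo `run/shared/lean/prim/rsw3/P1-QM.md` §32.

Gen 19 (8b) and (12) are stated for sequences `z : ℕ → ℤ^d` separated at ALL indices (convenient for the inductions).  For `k` given sites
only the first `k` matter; this file pads finite data (`‖z_0‖ ≥ n₁`, `ρ‖z_i‖ ≤ ‖z_{i+1}‖` for `i + 1 < k`) to an admissible sequence
(`z_i = ‖z_{k−1}‖ρ^{i+1−k}·e_0` beyond `k`) and restates the factorisation theorem with hypotheses on `i < k` only:

* `exists_separated_padding` — the padding;
* **`exists_iicMeasure_real_biInter_openConn_two_sided_fin`** — (A2)□(s,L) + `CU⁺_l` + UAD at `p_c(ℤ^d)`, `d ≥ 2`: there are `ρ, n₁, c, A, C` with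
  **`c^k ∏_{i<k} π(‖z_i‖)·ν(univ) ≤ ν(⋂_{i<k} {0 ↔ z_i}) ≤ A·C^k ∏_{i<k} π(‖z_i‖)`** for every IIC measure `ν`, every `k ≥ 1` and every `z` with
  `‖z_0‖ ≥ n₁` and `ρ‖z_i‖ ≤ ‖z_{i+1}‖` for `i + 1 < k`;
* `exists_iicMeasure_real_biInter_openConn_le_fin` — the upper half alone under (A2)□(s,L) (`‖z_0‖ ≥ 4`, `8‖z_i‖ ≤ ‖z_{i+1}‖` for `i + 1 < k`).
References: H. Kesten, Probab. Theory Relat. Fields 73 (1986), Thm. (8).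
-/

noncomputable section

namespace Summit.CriticalPhenomena.PercolationContinuityZ3.Theorems.Crossing

open MeasureTheory Filter Topology Literature.Probability.Percolation Literature.Probability.LatticeModels
open Literature.Probability.Percolation.DCT16
open Summit.CriticalPhenomena.PercolationContinuityZ3.Theorems.SurfaceTension

variable {d : ℕ}

/-- **Padding finite separated data** (`d ≥ 1`): sites `z_0, …, z_{k−1}` with `ρ·‖z_i‖ ≤ ‖z_{i+1}‖` for `i + 1 < k` extend to
a sequence `z̃` with `z̃_i = z_i` for `i < k` and `ρ·‖z̃_i‖ ≤ ‖z̃_{i+1}‖` for ALL `i` (continue with the sites `‖z_{k−1}‖ρ^{j}·e_0`). [folklore] -/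
theorem exists_separated_padding (hd : 1 ≤ d) (k ρ : ℕ) (z : ℕ → Site d)
    (hsep : ∀ i, i + 1 < k → ρ * Site.supNorm (z i) ≤ Site.supNorm (z (i + 1))) :
    ∃ z' : ℕ → Site d, (∀ i, i < k → z' i = z i) ∧ ∀ i, ρ * Site.supNorm (z' i) ≤ Site.supNorm (z' (i + 1)) := by
  set m : ℕ := Site.supNorm (z (k - 1)) with hm
  refine ⟨fun i => if i < k then z i else Pi.single (⟨0, hd⟩ : Fin d) ((m * ρ ^ (i + 1 - k) : ℕ) : ℤ), fun i hi => by simp [hi], fun i => ?_⟩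
  by_cases h1 : i + 1 < k
  · have h0 : i < k := by omega
    simp only [h0, h1, if_true]
    exact hsep i h1
  · by_cases h0 : i < k
    · -- `i = k - 1`
      have hik : i = k - 1 := by omega
      simp only [h0, h1, if_true, if_false]
      rw [supNorm_single_natCast hd, show i + 1 + 1 - k = 1 by omega, pow_one, hik, ← hm, mul_comm]
    · simp only [h0, h1, if_false]
      rw [supNorm_single_natCast hd, supNorm_single_natCast hd, show i + 1 + 1 - k = (i + 1 - k) + 1 by omega, pow_succ]
      exact le_of_eq (by ring)

/-- **THE MULTIPOINT FACTORISATION FOR FINITELY MANY SITES** (`p_c(ℤ^d)`, `d ≥ 2`; (A2)□ at aspect `(s,L)`, `2 ≤ s ≤ L`, `ϰ > 0`; `CU⁺_l(c_U)`,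
`l ≥ 2`, `c_U > 0`; UAD): there are `ρ, n₁ ≥ 1` and `c, A, C > 0` such that for every finite measure `ν` with Kesten's IIC limit property, every
`k ≥ 1` and all sites `z_0, …, z_{k−1}` with `‖z_0‖_∞ ≥ n₁` and `ρ·‖z_i‖_∞ ≤ ‖z_{i+1}‖_∞` for `i + 1 < k`:
**`c^k·∏_{i<k} π_{p_c}(‖z_i‖_∞)·ν(univ) ≤ ν(⋂_{i<k} {0 ↔ z_i}) ≤ A·C^k·∏_{i<k} π_{p_c}(‖z_i‖_∞)`**. [cite: Kesten1986, Thm. (8)]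
[cite: BasuSapozhnikov2017ECP, Thm. 1.1] -/
theorem exists_iicMeasure_real_biInter_openConn_two_sided_fin (hd : 2 ≤ d) {s L : ℕ} (hs : 2 ≤ s) (hsL : s ≤ L)
    {ϰ : ℝ} (hϰ : 0 < ϰ) (hA2 : SetToSetQuasiMultAspectAt d (criticalProbI d) s L ϰ) {l : ℕ} (hl : 2 ≤ l) {cU : ℝ} (hcU : 0 < cU)
    (hCU : ∀ a : ℕ, 1 ≤ a → ∀ E : Set (BondConfig (Site d)), IsUpperSet E → MeasurableSet E →
      cU * (bondPercolation (zdGraph d) (criticalProbI d)).real E ≤ (bondPercolation (zdGraph d) (criticalProbI d)).real (E ∩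
        {ω : BondConfig (Site d) | ∀ t ∈ innerBoundary (zdGraph d) (box d a), ∀ s ∈ innerBoundary (zdGraph d) (box d (l * a)),
          ∀ t' ∈ innerBoundary (zdGraph d) (box d a), ∀ s' ∈ innerBoundary (zdGraph d) (box d (l * a)),
          ω ∈ openConnIn (↑((box d (l * a) \ box d a) ∪ innerBoundary (zdGraph d) (box d a)) : Set (Site d)) t s →
          ω ∈ openConnIn (↑((box d (l * a) \ box d a) ∪ innerBoundary (zdGraph d) (box d a)) : Set (Site d)) t' s' →
          ω ∈ openConnIn (↑((box d (l * a) \ box d a) ∪ innerBoundary (zdGraph d) (box d a)) : Set (Site d)) s s'}))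
    (hUAD : ∀ ε : ℝ, 0 < ε → ∃ K₀ : ℕ, ∀ m : ℕ, 1 ≤ m → ∀ N : ℕ, K₀ * m ≤ N →
      (bondPercolation (zdGraph d) (criticalProbI d)).real (boxCrossing d m N) ≤ ε) :
    ∃ (ρ n₁ : ℕ) (c A C : ℝ), 1 ≤ ρ ∧ 1 ≤ n₁ ∧ 0 < c ∧ 0 < A ∧ 0 < C ∧ ∀ (ν : Measure (BondConfig (Site d))) [IsFiniteMeasure ν],
      (∀ (F : Finset (Sym2 (Site d))) (E : Set (BondConfig (Site d))), MeasurableSet E → DeterminedBy E ↑F →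
        Tendsto (fun n : ℕ => (bondPercolation (zdGraph d) (criticalProbI d)).real (E ∩ siteToBoundary d n) /
          oneArmProb d (criticalProbI d) n) atTop (𝓝 (ν.real E))) →
      ∀ (k : ℕ), 1 ≤ k → ∀ (z : ℕ → Site d), n₁ ≤ Site.supNorm (z 0) →
        (∀ i, i + 1 < k → ρ * Site.supNorm (z i) ≤ Site.supNorm (z (i + 1))) →
          c ^ k * (∏ i ∈ Finset.range k, oneArmProb d (criticalProbI d) (Site.supNorm (z i))) * ν.real Set.univ ≤
              ν.real (⋂ i ∈ Finset.range k, (openConn (0 : Site d) (z i) : Set (BondConfig (Site d)))) ∧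
            ν.real (⋂ i ∈ Finset.range k, (openConn (0 : Site d) (z i) : Set (BondConfig (Site d)))) ≤
              A * C ^ k * ∏ i ∈ Finset.range k, oneArmProb d (criticalProbI d) (Site.supNorm (z i)) := by
  have hd1 : 1 ≤ d := le_trans (by norm_num) hd
  obtain ⟨ρ, n₁, c, A, C, hρ, hn₁, hc, hA, hC, h⟩ :=
    exists_iicMeasure_real_biInter_openConn_two_sided_of_separated hd hs hsL hϰ hA2 hl hcU hCU hUAD
  refine ⟨ρ, n₁, c, A, C, hρ, hn₁, hc, hA, hC, fun ν _ hν k hk z hz0 hsep => ?_⟩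
  obtain ⟨z', hz', hsep'⟩ := exists_separated_padding hd1 k ρ z hsep
  have h0' : n₁ ≤ Site.supNorm (z' 0) := by rw [hz' 0 (by omega)]; exact hz0
  have hres := h ν hν z' h0' hsep' k hk
  have hset : (⋂ i ∈ Finset.range k, (openConn (0 : Site d) (z' i) : Set (BondConfig (Site d)))) =
      ⋂ i ∈ Finset.range k, (openConn (0 : Site d) (z i) : Set (BondConfig (Site d))) :=
    Set.iInter₂_congr fun i hi => by rw [hz' i (Finset.mem_range.1 hi)]
  have hprod : ∏ i ∈ Finset.range k, oneArmProb d (criticalProbI d) (Site.supNorm (z' i)) =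
      ∏ i ∈ Finset.range k, oneArmProb d (criticalProbI d) (Site.supNorm (z i)) :=
    Finset.prod_congr rfl fun i hi => by rw [hz' i (Finset.mem_range.1 hi)]
  rw [hset, hprod] at hres
  exact hres

/-- **THE MULTIPOINT UPPER BOUND FOR FINITELY MANY SITES, (A2)□ ALONE** (`p_c(ℤ^d)`, `d ≥ 2`, (A2)□(s,L)): there are `A, C > 0` with
**`ν(⋂_{i<k} {0 ↔ z_i}) ≤ A·C^k·∏_{i<k} π_{p_c}(‖z_i‖_∞)`** for every IIC measure `ν`, every `k ≥ 1` and all sites with `‖z_0‖_∞ ≥ 4` and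
`8·‖z_i‖_∞ ≤ ‖z_{i+1}‖_∞` for `i + 1 < k`. [cite: Kesten1986, Thm. (8)] -/
theorem exists_iicMeasure_real_biInter_openConn_le_fin (hd : 2 ≤ d) {s L : ℕ} (hs : 2 ≤ s) (hsL : s ≤ L) {ϰ : ℝ}
    (hϰ : 0 < ϰ) (hA2 : SetToSetQuasiMultAspectAt d (criticalProbI d) s L ϰ) :
    ∃ A C : ℝ, 0 < A ∧ 0 < C ∧ ∀ (ν : Measure (BondConfig (Site d))) [IsFiniteMeasure ν],
      (∀ (F : Finset (Sym2 (Site d))) (E : Set (BondConfig (Site d))), MeasurableSet E → DeterminedBy E ↑F →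
        Tendsto (fun n : ℕ => (bondPercolation (zdGraph d) (criticalProbI d)).real (E ∩ siteToBoundary d n) /
          oneArmProb d (criticalProbI d) n) atTop (𝓝 (ν.real E))) →
      ∀ (k : ℕ), 1 ≤ k → ∀ (z : ℕ → Site d), 4 ≤ Site.supNorm (z 0) →
        (∀ i, i + 1 < k → 8 * Site.supNorm (z i) ≤ Site.supNorm (z (i + 1))) →
          ν.real (⋂ i ∈ Finset.range k, (openConn (0 : Site d) (z i) : Set (BondConfig (Site d)))) ≤
            A * C ^ k * ∏ i ∈ Finset.range k, oneArmProb d (criticalProbI d) (Site.supNorm (z i)) := by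
  have hd1 : 1 ≤ d := le_trans (by norm_num) hd
  obtain ⟨A, C, hA, hC, h⟩ := exists_iicMeasure_real_biInter_openConn_le_criticalProbI hd hs hsL hϰ hA2
  refine ⟨A, C, hA, hC, fun ν _ hν k hk z hz0 hsep => ?_⟩
  obtain ⟨z', hz', hsep'⟩ := exists_separated_padding hd1 k 8 z hsep
  have h0' : 4 ≤ Site.supNorm (z' 0) := by rw [hz' 0 (by omega)]; exact hz0
  have hres := h ν hν (fun i => Site.supNorm (z' i)) h0' hsep' z' (fun i => self_mem_sphere (z' i)) k hk
  have hset : (⋂ i ∈ Finset.range k, (openConn (0 : Site d) (z' i) : Set (BondConfig (Site d)))) =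
      ⋂ i ∈ Finset.range k, (openConn (0 : Site d) (z i) : Set (BondConfig (Site d))) :=
    Set.iInter₂_congr fun i hi => by rw [hz' i (Finset.mem_range.1 hi)]
  have hprod : ∏ i ∈ Finset.range k, oneArmProb d (criticalProbI d) (Site.supNorm (z' i)) =
      ∏ i ∈ Finset.range k, oneArmProb d (criticalProbI d) (Site.supNorm (z i)) :=
    Finset.prod_congr rfl fun i hi => by rw [hz' i (Finset.mem_range.1 hi)]
  rw [hset, hprod] at hres
  exact hres

end Summit.CriticalPhenomena.PercolationContinuityZ3.Theorems.Crossing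

end
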